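import Literature.MathematicalPhysics.QuantumLattice.HeisenbergOrderNeelKernelSumRule
import Literature.MathematicalPhysics.QuantumLattice.HeisenbergCorrelationGramWindows
import HarnessLib

/-!
# The dictionary infrared bound as an `L`-uniform linear cut on a window of correlations

Literature: Kennedy–Lieb–Shastry, *J. Stat. Phys.* **53** (1988) 1019, eqs. (1)–(3), (6)–(9),
p. 1021 [cite: KLS1988JSP, eqs. (6)–(9)] (the sum-rule / infrared-bound method with a trial kernel).

`HeisenbergOrderNeelKernelSumRule.lean` proves, for an ARBITRARY real weight `κ` on shifts `z` of the
square torus of even side `L = 2k ≥ 4`, the dictionary bounds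
`b(-ε) - t S(S+1)/3 - (-ε/2)^{1/2} 𝓦_K ≤ Φ_κ` and `-t S(S+1)/3 - 𝓦_K²/(8b) ≤ Φ_κ`
(`Φ_κ = Σ_z κ(z) c(z)`, `K = Σ_z κ(z) cos(p·z) + b(cos q₁ + cos q₂)/2 + t`, `K(Q) ≥ 0`).
This file specialises the weight to a **window dictionary**: a finite table `w` on natural-number
shifts `(a, b) ∈ S`, symmetrised under the reflection of the second axis,
`κ_w = Σ_{(a,b) ∈ S} (w(a,b)/2)(δ_{(a,b)} + δ_{(a,-b)})`, for which

* `Φ_{κ_w} = Σ_{(a,b) ∈ S} w(a,b) c(a,b)` in the natural-number API `c(a,b) = heisRedCorr2 L n a b`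
  (`klsKernelCorr_windowDict`; the folding `c(a,-b) = c(a,b)` is `heisGroundCorr_zero_vec2_neg_snd`);
* the kernel is the trigonometric polynomial `K(q) = Σ w(a,b) cos(a q₁) cos(b q₂) + b(cos q₁ + cos q₂)/2 + t`
  (`klsKernel_windowDict`), i.e. a polynomial in `(cos q₁, cos q₂)` by Chebyshev — the form in which an
  `L`-uniform majorant of the punctured Riemann sum `𝓦_K(L)` is certified — and
  `K(Q) = Σ w(a,b) (-1)^{a+b} - b + t` (`klsKernel_windowDict_neelIndex`);
* **the cuts** (all hypotheses numerical): given `K(Q) ≥ 0` and ANY upper bound `𝓦_K(L) ≤ W̄`,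
  (E) `-t S(S+1)/3 - W̄²/(8b) ≤ Σ w(a,b) c(a,b)` for `b > 0` (`kls_heis_windowDict_lower_energyFree`), and
  (T) for every tangent point `x₀ > 0`,
  `b(-c(0,1)) - t S(S+1)/3 - W̄ (x₀/2 + (-c(0,1))/(4 x₀)) ≤ Σ w(a,b) c(a,b)` (`kls_heis_windowDict_cut`):
  the energy-retained bound with `ε = c(0,1)` (`heisBondCorr_two_eq`) and the concave square root
  replaced by its tangent, `(-ε/2)^{1/2} ≤ x₀/2 + (-ε)/(4x₀)` — LINEAR in the unknowns `c(0,1)` and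
  `c(a,b)`, valid on every torus of even side `2k ≥ 4` at once.

Together with the window Gram cuts of `HeisenbergCorrelationGramWindows.lean` (positivity, reflection
positivity) and `c(0,0) = S(S+1)/3`, `|c| ≤ c(0,0)`, these are all the rows of an `L`-uniform linear
programme on finitely many correlation values; only the constants `W̄` are kernel-specific.

Everything is proved; no named facts.  (Written for the pub-hubbard certificate ladder — ladder R1–R4
with certified numbers; no claim on H/H₀.)
-/

noncomputable section

open Finset Literature.Probability.LatticeModels

namespace Literature.MathematicalPhysics.QuantumLattice

/-! ### The window dictionary -/

/-- **The window dictionary** of a finite table `w` on natural-number shifts: the weight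
`κ_w(z) = Σ_{(a,b) ∈ S} (w(a,b)/2)([z = (a,b)] + [z = (a,-b)])` on the torus of side `L`.
[Kennedy–Lieb–Shastry 1988, eqs. (6)–(9) (method)] [folklore] -/
def windowDict (L : ℕ) [NeZero L] (S : Finset (ℕ × ℕ)) (w : ℕ × ℕ → ℝ) : TorusSite 2 L → ℝ :=
  fun z => ∑ p ∈ S, w p / 2 *
    ((if z = ![((p.1 : ℕ) : ZMod L), ((p.2 : ℕ) : ZMod L)] then 1 else 0) +
      (if z = ![((p.1 : ℕ) : ZMod L), -((p.2 : ℕ) : ZMod L)] then 1 else 0))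

/-- Pairing the window dictionary with any function: `Σ_z κ_w(z) F(z) = Σ_{(a,b)} (w/2)(F(a,b) + F(a,-b))`.
[folklore] -/
private theorem sum_windowDict_mul (L : ℕ) [NeZero L] (S : Finset (ℕ × ℕ)) (w : ℕ × ℕ → ℝ)
    (F : TorusSite 2 L → ℝ) :
    ∑ z : TorusSite 2 L, windowDict L S w z * F z =
      ∑ p ∈ S, w p / 2 * (F ![((p.1 : ℕ) : ZMod L), ((p.2 : ℕ) : ZMod L)] +
        F ![((p.1 : ℕ) : ZMod L), -((p.2 : ℕ) : ZMod L)]) := by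
  unfold windowDict
  simp_rw [sum_mul]
  rw [sum_comm]
  refine sum_congr rfl fun p _ => ?_
  have e : ∀ z : TorusSite 2 L,
      w p / 2 * ((if z = ![((p.1 : ℕ) : ZMod L), ((p.2 : ℕ) : ZMod L)] then (1 : ℝ) else 0) +
          (if z = ![((p.1 : ℕ) : ZMod L), -((p.2 : ℕ) : ZMod L)] then (1 : ℝ) else 0)) * F z =
        w p / 2 * ((if z = ![((p.1 : ℕ) : ZMod L), ((p.2 : ℕ) : ZMod L)] then F z else 0) +
          (if z = ![((p.1 : ℕ) : ZMod L), -((p.2 : ℕ) : ZMod L)] then F z else 0)) := by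
    intro z
    split_ifs <;> ring
  rw [sum_congr rfl fun z _ => e z, ← mul_sum, sum_add_distrib, sum_ite_eq' univ, sum_ite_eq' univ]
  simp

/-- **The correlation functional of a window dictionary**: `Φ_{κ_w} = Σ_{(a,b) ∈ S} w(a,b) c(a,b)`
(`c(a,-b) = c(a,b)` by the reflection of the second axis). [Kennedy–Lieb–Shastry 1988, p. 1021]
[cite: KLS1988JSP, eqs. (6)-(9)] -/
theorem klsKernelCorr_windowDict (L : ℕ) [NeZero L] (n : ℕ) (S : Finset (ℕ × ℕ)) (w : ℕ × ℕ → ℝ) :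
    klsKernelCorr L n (windowDict L S w) = ∑ p ∈ S, w p * heisRedCorr2 L n p.1 p.2 := by
  unfold klsKernelCorr
  rw [sum_windowDict_mul]
  refine sum_congr rfl fun p _ => ?_
  rw [heisGroundCorr_zero_vec2_neg_snd, heisRedCorr2]
  ring

/-- `Pi.single 0 a + Pi.single 1 b = (a, b)` and `Pi.single 0 a - Pi.single 1 b = (a, -b)` on `Fin 2`. [folklore] -/
private theorem single_add_single (L : ℕ) (a b : ZMod L) :
    (Pi.single (0 : Fin 2) a + Pi.single (1 : Fin 2) b : TorusSite 2 L) = ![a, b] ∧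
      (Pi.single (0 : Fin 2) a - Pi.single (1 : Fin 2) b : TorusSite 2 L) = ![a, -b] := by
  constructor <;> (ext j; fin_cases j <;> simp)

/-- **The oscillatory part of a window-dictionary kernel is a cosine polynomial**:
`Σ_z κ_w(z) cos(p_q·z) = Σ_{(a,b)} w(a,b) cos(a q₁) cos(b q₂)` (`2 cos α cos β = cos(α+β) + cos(α-β)`).
[Kennedy–Lieb–Shastry 1988, eqs. (6)–(9)] [cite: KLS1988JSP, eqs. (6)-(9)] -/
theorem sum_windowDict_mul_cos (L : ℕ) [NeZero L] (S : Finset (ℕ × ℕ)) (w : ℕ × ℕ → ℝ)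
    (q : TorusSite 2 L) :
    ∑ z : TorusSite 2 L, windowDict L S w z * Real.cos (torusPhase L q z) =
      ∑ p ∈ S, w p * (Real.cos ((p.1 : ℝ) * latticeMomentum L q 0) *
        Real.cos ((p.2 : ℝ) * latticeMomentum L q 1)) := by
  rw [sum_windowDict_mul]
  refine sum_congr rfl fun p _ => ?_
  rw [cos_natCast_mul_latticeMomentum L q 0 p.1, cos_natCast_mul_latticeMomentum L q 1 p.2,
    cos_torusPhase_mul_cos_torusPhase, (single_add_single L _ _).1, (single_add_single L _ _).2]
  ring

/-- **The window-dictionary kernel**: `K(q) = Σ_{(a,b)} w(a,b) cos(a q₁) cos(b q₂) + b(cos q₁ + cos q₂)/2 + t`.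
[Kennedy–Lieb–Shastry 1988, eqs. (6)–(9)] [cite: KLS1988JSP, eqs. (6)-(9)] -/
theorem klsKernel_windowDict (L : ℕ) [NeZero L] (S : Finset (ℕ × ℕ)) (w : ℕ × ℕ → ℝ) (b t : ℝ)
    (q : TorusSite 2 L) :
    klsKernel L (windowDict L S w) b t q =
      ∑ p ∈ S, w p * (Real.cos ((p.1 : ℝ) * latticeMomentum L q 0) *
          Real.cos ((p.2 : ℝ) * latticeMomentum L q 1)) + b * (torusCosSum L q / 2) + t := by
  unfold klsKernel
  rw [sum_windowDict_mul_cos]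

/-- **The kernel at the Néel point**: `K(Q) = Σ_{(a,b)} w(a,b) (-1)^{a+b} - b + t` (`Qᵢ = π`,
`cos(aπ) = (-1)^a`). [Kennedy–Lieb–Shastry 1988, eqs. (6)–(9)] [cite: KLS1988JSP, eqs. (6)-(9)] -/
theorem klsKernel_windowDict_neelIndex (k : ℕ) [NeZero (2 * k)] (S : Finset (ℕ × ℕ)) (w : ℕ × ℕ → ℝ)
    (b t : ℝ) :
    klsKernel (2 * k) (windowDict (2 * k) S w) b t (neelIndex (2 * k)) =
      ∑ p ∈ S, w p * (-1 : ℝ) ^ (p.1 + p.2) - b + t := by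
  rw [klsKernel_windowDict, torusCosSum_neelIndex k]
  simp_rw [latticeMomentum_neelIndex k, Real.cos_nat_mul_pi, ← pow_add]
  push_cast
  ring

/-! ### The cuts -/

/-- **(E) The energy-free window cut.** On every square torus of even side `2k ≥ 4`: if `b > 0`,
`K(Q) = Σ w(a,b)(-1)^{a+b} - b + t ≥ 0` and `𝓦_K(2k) ≤ W̄`, then
`-t S(S+1)/3 - W̄²/(8b) ≤ Σ_{(a,b) ∈ S} w(a,b) c(a,b)` for the spin-`n/2` antiferromagnet.
[Kennedy–Lieb–Shastry 1988, eqs. (6)–(9) (with `e₀` eliminated)] [cite: KLS1988JSP, eqs. (6)-(9)] -/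
theorem kls_heis_windowDict_lower_energyFree (n k : ℕ) (hk : 2 ≤ k) [NeZero (2 * k)]
    (S : Finset (ℕ × ℕ)) (w : ℕ × ℕ → ℝ) {b t Wbar : ℝ} (hb : 0 < b)
    (hK : 0 ≤ ∑ p ∈ S, w p * (-1 : ℝ) ^ (p.1 + p.2) - b + t)
    (hW : klsKernelRiemannSum (2 * k) (windowDict (2 * k) S w) b t ≤ Wbar) :
    -t * ((n : ℝ) / 2 * ((n : ℝ) / 2 + 1) / 3) - Wbar ^ 2 / (8 * b) ≤
      ∑ p ∈ S, w p * heisRedCorr2 (2 * k) n p.1 p.2 := by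
  have hK' : 0 ≤ klsKernel (2 * k) (windowDict (2 * k) S w) b t (neelIndex (2 * k)) := by
    rwa [klsKernel_windowDict_neelIndex]
  have h := kls_heis_kernelCorr_lower_energyFree n k hk (windowDict (2 * k) S w) hb hK'
  rw [klsKernelCorr_windowDict] at h
  have h0 := klsKernelRiemannSum_nonneg (2 * k) (windowDict (2 * k) S w) b t
  have h2 : klsKernelRiemannSum (2 * k) (windowDict (2 * k) S w) b t ^ 2 ≤ Wbar ^ 2 :=
    pow_le_pow_left₀ h0 hW 2
  have h3 : klsKernelRiemannSum (2 * k) (windowDict (2 * k) S w) b t ^ 2 / (8 * b) ≤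
      Wbar ^ 2 / (8 * b) := div_le_div_of_nonneg_right h2 (by positivity)
  linarith

/-- The tangent of the square root: `(y)^{1/2} ≤ x₀/2 + y/(2x₀)` for `y ≥ 0 < x₀`
(`((y)^{1/2} - x₀)² ≥ 0`). [folklore] -/
private theorem sqrt_le_tangent {y x₀ : ℝ} (hy : 0 ≤ y) (hx : 0 < x₀) :
    Real.sqrt y ≤ x₀ / 2 + y / (2 * x₀) := by
  set s := Real.sqrt y with hs
  have hs2 : s ^ 2 = y := Real.sq_sqrt hy
  have key : x₀ / 2 + y / (2 * x₀) - s = (s - x₀) ^ 2 / (2 * x₀) := by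
    rw [← hs2]
    field_simp
    ring
  have : 0 ≤ (s - x₀) ^ 2 / (2 * x₀) := by positivity
  linarith

/-- **(T) The energy-retained window cut, linearised at a tangent point.** On every square torus of
even side `2k ≥ 4`: if `K(Q) ≥ 0`, `𝓦_K(2k) ≤ W̄` and `x₀ > 0`, then with the nearest-neighbour
correlation `c(0,1) = ε` (the ground-state energy per bond),
`b(-c(0,1)) - t S(S+1)/3 - W̄ (x₀/2 + (-c(0,1))/(4x₀)) ≤ Σ_{(a,b) ∈ S} w(a,b) c(a,b)`
— linear in the unknowns `c(0,1)`, `c(a,b)`; the square root `(-ε/2)^{1/2}` of the retained bound is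
replaced by its tangent at `x₀` (equality iff `-ε/2 = x₀²`). [Kennedy–Lieb–Shastry 1988, eqs. (6)–(9)]
[cite: KLS1988JSP, eqs. (6)-(9)] -/
theorem kls_heis_windowDict_cut (n k : ℕ) (hk : 2 ≤ k) [NeZero (2 * k)]
    (S : Finset (ℕ × ℕ)) (w : ℕ × ℕ → ℝ) {b t Wbar x₀ : ℝ} (hx : 0 < x₀)
    (hK : 0 ≤ ∑ p ∈ S, w p * (-1 : ℝ) ^ (p.1 + p.2) - b + t)
    (hW : klsKernelRiemannSum (2 * k) (windowDict (2 * k) S w) b t ≤ Wbar) :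
    b * (-heisRedCorr2 (2 * k) n 0 1) - t * ((n : ℝ) / 2 * ((n : ℝ) / 2 + 1) / 3) -
        Wbar * (x₀ / 2 + (-heisRedCorr2 (2 * k) n 0 1) / (4 * x₀)) ≤
      ∑ p ∈ S, w p * heisRedCorr2 (2 * k) n p.1 p.2 := by
  have hK' : 0 ≤ klsKernel (2 * k) (windowDict (2 * k) S w) b t (neelIndex (2 * k)) := by
    rwa [klsKernel_windowDict_neelIndex]
  have h := kls_heis_kernelSumRule_drop n k hk (windowDict (2 * k) S w) (b := b) (t := t) hK'
  rw [klsKernelCorr_windowDict] at h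
  have hε : heisBondCorr (d := 2) 0 (2 * k) n = heisRedCorr2 (2 * k) n 0 1 := by
    rw [heisBondCorr_two_eq, heisRedCorr2_swap (2 * k) n 1 0]
    ring
  have hN := heisBondCorr_le (d := 2) (by norm_num) n k hk
  rw [hε] at h hN
  set ε := heisRedCorr2 (2 * k) n 0 1 with hεdef
  set W := klsKernelRiemannSum (2 * k) (windowDict (2 * k) S w) b t with hWdef
  have h0 : 0 ≤ W := klsKernelRiemannSum_nonneg (2 * k) (windowDict (2 * k) S w) b t
  have hWbar : 0 ≤ Wbar := h0.trans hW
  have hy : 0 ≤ -ε / 2 := by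
    have : 0 ≤ ((n : ℝ) / 2) ^ 2 / 3 := by positivity
    linarith
  have hs0 : 0 ≤ Real.sqrt (-ε / 2) := Real.sqrt_nonneg _
  have htan : Real.sqrt (-ε / 2) ≤ x₀ / 2 + -ε / (4 * x₀) := by
    have := sqrt_le_tangent hy hx
    have e : -ε / 2 / (2 * x₀) = -ε / (4 * x₀) := by
      field_simp
      ring
    linarith
  have h1 : Real.sqrt (-ε / 2) * W ≤ Real.sqrt (-ε / 2) * Wbar := mul_le_mul_of_nonneg_left hW hs0
  have h2 : Real.sqrt (-ε / 2) * Wbar ≤ (x₀ / 2 + -ε / (4 * x₀)) * Wbar :=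
    mul_le_mul_of_nonneg_right htan hWbar
  linarith

/-- **Spin ½, energy-free** (the form used by the HubbardLadder cell): for every even side `2k ≥ 4`,
`-t/4 - W̄²/(8b) ≤ Σ_{(a,b) ∈ S} w(a,b) c_{2k}(a,b)` whenever `b > 0`, `Σ w(a,b)(-1)^{a+b} - b + t ≥ 0`
and `𝓦_K(2k) ≤ W̄`. [Kennedy–Lieb–Shastry 1988, eqs. (6)–(9), p. 1023] [cite: KLS1988JSP, eqs. (6)-(9)] -/
theorem kls_heis_windowDict_lower_energyFree_spinHalf (k : ℕ) (hk : 2 ≤ k) [NeZero (2 * k)]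
    (S : Finset (ℕ × ℕ)) (w : ℕ × ℕ → ℝ) {b t Wbar : ℝ} (hb : 0 < b)
    (hK : 0 ≤ ∑ p ∈ S, w p * (-1 : ℝ) ^ (p.1 + p.2) - b + t)
    (hW : klsKernelRiemannSum (2 * k) (windowDict (2 * k) S w) b t ≤ Wbar) :
    -t / 4 - Wbar ^ 2 / (8 * b) ≤ ∑ p ∈ S, w p * heisRedCorr2 (2 * k) 1 p.1 p.2 := by
  have h := kls_heis_windowDict_lower_energyFree 1 k hk S w hb hK hW
  norm_num at h
  linarith

/-- **Spin ½, tangent form**: for every even side `2k ≥ 4` and every `x₀ > 0`,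
`b(-c(0,1)) - t/4 - W̄ (x₀/2 + (-c(0,1))/(4x₀)) ≤ Σ_{(a,b) ∈ S} w(a,b) c_{2k}(a,b)` whenever
`Σ w(a,b)(-1)^{a+b} - b + t ≥ 0` and `𝓦_K(2k) ≤ W̄`. [Kennedy–Lieb–Shastry 1988, eqs. (6)–(9)]
[cite: KLS1988JSP, eqs. (6)-(9)] -/
theorem kls_heis_windowDict_cut_spinHalf (k : ℕ) (hk : 2 ≤ k) [NeZero (2 * k)]
    (S : Finset (ℕ × ℕ)) (w : ℕ × ℕ → ℝ) {b t Wbar x₀ : ℝ} (hx : 0 < x₀)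
    (hK : 0 ≤ ∑ p ∈ S, w p * (-1 : ℝ) ^ (p.1 + p.2) - b + t)
    (hW : klsKernelRiemannSum (2 * k) (windowDict (2 * k) S w) b t ≤ Wbar) :
    b * (-heisRedCorr2 (2 * k) 1 0 1) - t / 4 -
        Wbar * (x₀ / 2 + (-heisRedCorr2 (2 * k) 1 0 1) / (4 * x₀)) ≤
      ∑ p ∈ S, w p * heisRedCorr2 (2 * k) 1 p.1 p.2 := by
  have h := kls_heis_windowDict_cut 1 k hk S w hx hK hW
  norm_num at h
  linarith

end Literature.MathematicalPhysics.QuantumLattice
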